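import Literature.MathematicalPhysics.QuantumFieldTheory.Balaban1983to89.T4BetaReadOut
import Summits.QuantumFields.BalabanUV.T4Continuum.Spine.NE5.TwoRunTorusNE5

/-!
# BalabanUVNodes ∕ N18 coherence — what node U3's SIBLING shapes (N22 = NE9 ∧ fading memory, N19's argument bracket
# `LipBackground`, the (D4) read-out `RepresentsA∕B`) say AT THE NE5 CHAIN'S CARRIERS OF RECORD `torusCarriers N W`
# with the real read-outs `reFunctional` (Track A, DAG node N18; cluster K4 «SpineRates», located typing point for the
# SHARED `U3Carriers` of the D59 supply `BalabanUVNodesSpineRates`)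

HONEST FRAMING.  Count-neutral kernel bookkeeping (vacuity ∕ coherence audit in the referees' A1–A6 sense); nothing of
Bałaban's is asserted; NE5 ∕ NE9 ∕ NE4 NOT IN PRINT and NOT PROVED; one finite four-torus programme at fixed ε; nothing
continuum ∕ ℝ⁴ ∕ OS ∕ mass-gap ∕ Clay.  0 `sorry`, 0 `def`, standard axioms.

THE POINT.  Cluster K4 types N17 (NE4 on the datum), N18 (NE5), N22 (NE9 ∧ fading memory) and the (D4) β-read-out over
ONE shared bundle of node-U3 carriers `(C, W, γ, κ, EA, EB, θ, C₅, Λ, C₉, ω, …)` (dagwriter g75 word §2 (b): both tree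
consumers of NE9 — `T4OutputRate.u3_threeBrackets` → N19 and `Spine.NE4.Targets.u2Inputs_of_u3` → N17 — read NE9 on run
A's functional with NE5's window and decay).  The END of row NE5 (`Spine.NE5.TwoRunTorusNE5Final8.ne5_end_final_all8`)
concludes `NE5` at the carriers `Spine.NE5.TwoRunTorusNE5.torusCarriers N W` (gauge `:= 0`, transport `:= id`) with the
functionals `reFunctional N W E := fun _ U X => …` which DO NOT READ THE COUPLING ARGUMENT (its docstring: *"the
coupling argument is not read by the model"*).  Kernel facts recorded here, so that NODE 00's later-stage record
predicate (`defn-IsRecordOfRecord₅` and the rate-record predicate `RRec`) is typed with them in view: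
* §1 on ANY carriers with gauge `≡ 0`, `LipBackground EA W κ CU` (N19's argument bracket) says EXACTLY that `EA` does
  not depend on the background (`lipBackground_iff_of_gauge_zero`), and `BackgroundsClose` (NE3's consumer shape) is
  free (`backgroundsClose_of_gauge_zero`); at `torusCarriers` both apply (`torusCarriers_gauge`);
* §2 a functional that does not read the couplings satisfies `NE9` with the ZERO history moduli and `FadingMemory 0 ω 0`
  (`ne9_zero_of_couplingBlind`, `fadingMemory_zero`) — so N22's shape HOLDS VACUOUSLY at `reFunctional`
  (`ne9_reFunctional`): a discharge of N22 at these carriers would carry no content;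
* §3 if such a functional REPRESENTS the datum's β-functions (`T4BetaReadOut.RepresentsA`, the (D4) read-out binder of
  N17's glue `n17At_of_u3`), then every `β k` is CONSTANT on the box `]0, γ]^{k+1}` (`representsA_const_of_couplingBlind`,
  `representsA_reFunctional_const`); for run B's family `b ↦ reFunctional N W (E₁ b)`, `β (k+1) w` depends on `w 0` alone
  (`representsB_reFunctional_head`).  Bałaban's β_{k+1}(g_k) ([Balaban1987RG1] (0.20) p. 256, (1.20)–(1.22) p. 264) is
  not asserted constant anywhere; so the U3 carriers OF RECORD must read the coupling sequence (as the tree's one-point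
  β-carrier `T4BetaReadOut.betaCarriers ∕ betaEA` does) — the NE5 END is then invoked PER COUPLING SEQUENCE with
  constants uniform on the window, and its `gauge := 0 ∕ transport := id` conventions are NE5-internal, not U3's.
* §4 THE POSITIVE COUNTERPART: on the SAME carriers the coupling-READING read-out `g ↦ reFunctional N W (E g) g` of a
  coupling-indexed output family carries N18's K4 family shape from PER-COUPLING data with window-uniform constants
  (`ne5_family_couplingReading_of_primitive_rate`, the companion's §3a applied at each `g ∈ W′`); at this read-out §2–§3 no
  longer apply (NE9 and the β-read-out regain content), §1 (gauge `0`) still does.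
None of this touches the NE5 chain's theorems (they hold as stated); it locates WHICH reading of «the carriers of record»
the shared bundle can bear.  Companion: `BalabanUVNodesN18Knit` (the K4 family shape of N18 at these carriers).

Sources: T. Bałaban, CMP **109** (1987) [Balaban1987RG1] (0.20) p. 256, (0.24)–(0.25) p. 257, §1 p. 263, (1.20)–(1.22)
p. 264.  Nothing here is a claim about the Yang–Mills mass gap.
-/

noncomputable section

namespace Summit.QuantumFields.YangMills.BalabanUVNodes.N18Coherence

open Literature.MathematicalPhysics.QuantumFieldTheory.Balaban1983to89
open Literature.MathematicalPhysics.QuantumFieldTheory.Balaban1983to89.FlowStep (Box HBeta)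
open Literature.MathematicalPhysics.QuantumFieldTheory.Balaban1983to89.T4OutputRate
  (Carriers Functional NE5 NE9 FadingMemory LipBackground BackgroundsClose)
open Literature.MathematicalPhysics.QuantumFieldTheory.Balaban1983to89.T4BetaReadOut (ReadOut RepresentsA RepresentsB)
open Literature.MathematicalPhysics.QuantumFieldTheory.Balaban1983to89.TreeLengthTorus (TDom tsys)
open Literature.MathematicalPhysics.QuantumFieldTheory.Balaban1983to89.B13Lemma3Torus (TwoTorusStep)
open Summit.QuantumFields.BalabanUV.T4Continuum.Spine.NE5.TwoRunTorusNE5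
  (torusCarriers reFunctional ne5_of_torus_rates_all_scales)

/-! ## §1 Gauge-zero carriers: the argument bracket is background-independence, closeness is free -/

/-- On carriers whose closeness gauge vanishes identically, `LipBackground EA W κ CU` ([Balaban1988Convergent]
(2.27)–(2.28)-shaped Lipschitz dependence on the background, N19's argument bracket in `u3_threeBrackets`) holds iff
`EA` does not depend on the background at all. [folklore] -/
theorem lipBackground_iff_of_gauge_zero {C : Carriers} (hC : ∀ U U', C.gauge U U' = 0) {EA : Functional C C.BgA}
    {W : Set (ℕ → ℝ)} {κ : ℝ} {CU : (ℕ → ℝ) → ℕ → ℝ} :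
    LipBackground EA W κ CU ↔ ∀ g ∈ W, ∀ (U U' : C.BgA) (X : C.Dom), EA g U X = EA g U' X := by
  constructor
  · intro h g hg U U' X
    have h0 := h g hg U U' X
    rw [hC, mul_zero] at h0
    exact sub_eq_zero.mp (abs_nonpos_iff.mp h0)
  · intro h g hg U U' X
    rw [h g hg U U' X, sub_self, abs_zero, hC, mul_zero]

/-- On gauge-zero carriers NE3's consumer shape `BackgroundsClose uA uB δ` holds for every `δ ≥ 0`, whatever the two
runs' background maps. [folklore] -/
theorem backgroundsClose_of_gauge_zero {C : Carriers} (hC : ∀ U U', C.gauge U U' = 0) {V : Type} (uA : V → C.BgA)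
    (uB : V → C.BgB) {δ : ℝ} (hδ : 0 ≤ δ) : BackgroundsClose uA uB δ :=
  fun v => by rw [hC]; exact hδ

variable {L : ℕ} [NeZero L]

/-- The NE5 chain's torus carriers have gauge `0` (by definition, `TwoRunTorusNE5.torusCarriers`). [folklore] -/
theorem torusCarriers_gauge (N : ℕ → ℕ) [∀ j, NeZero (N j)] (W : (j : ℕ) → TwoTorusStep 4 L (N j))
    (U U' : (torusCarriers N W).BgA) : (torusCarriers N W).gauge U U' = 0 := rfl

/-- Hence at the torus carriers the argument bracket `LipBackground` is background-INDEPENDENCE of run A's functional —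
not a property of a one-step output that reads its background; N19's three-bracket road needs carriers with a genuine
gauge. [folklore] -/
theorem lipBackground_torusCarriers_iff (N : ℕ → ℕ) [∀ j, NeZero (N j)] (W : (j : ℕ) → TwoTorusStep 4 L (N j))
    {EA : Functional (torusCarriers N W) (torusCarriers N W).BgA} {W' : Set (ℕ → ℝ)} {κ : ℝ}
    {CU : (ℕ → ℝ) → ℕ → ℝ} :
    LipBackground EA W' κ CU ↔
      ∀ g ∈ W', ∀ (U U' : (torusCarriers N W).BgA) (X : (torusCarriers N W).Dom), EA g U X = EA g U' X :=
  lipBackground_iff_of_gauge_zero (torusCarriers_gauge N W)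

/-! ## §2 Coupling-blind functionals: NE9 with zero moduli, fading memory for free -/

/-- A functional that does not read the coupling sequence satisfies `NE9` with the ZERO history moduli, on any window
and at any decay rate. [folklore] -/
theorem ne9_zero_of_couplingBlind {C : Carriers} {Bg : Type} {E : Functional C Bg}
    (hE : ∀ (g g' : ℕ → ℝ) (U : Bg) (X : C.Dom), E g U X = E g' U X) (W : Set (ℕ → ℝ)) (κ : ℝ) :
    NE9 E W κ (fun _ _ => 0) := by
  intro g _ g' _ U X
  rw [hE g g' U X, sub_self, abs_zero]
  simp

/-- The zero moduli have fading memory with constant `0` at every `ω`. [folklore] -/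
theorem fadingMemory_zero (ω : ℝ) : FadingMemory 0 ω (fun _ _ => 0) :=
  fun _ _ _ => ⟨le_rfl, by simp⟩

/-- `reFunctional N W E` does not read the coupling argument (by definition). [folklore] -/
theorem reFunctional_couplingBlind (N : ℕ → ℕ) [∀ j, NeZero (N j)] (W : (j : ℕ) → TwoTorusStep 4 L (N j))
    (E : (j : ℕ) → TDom 4 (N j) → (W j).Φ → ℂ) (g g' : ℕ → ℝ) (U : (torusCarriers N W).BgB)
    (X : (torusCarriers N W).Dom) : reFunctional N W E g U X = reFunctional N W E g' U X := rfl

/-- **N22's shape is VACUOUS at the NE5 chain's read-outs**: `NE9 (reFunctional N W E) W′ κ 0 ∧ FadingMemory 0 ω 0` for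
every window, decay rate and `ω` — a «discharge» of N22 at these carriers would carry no content; the history dependence
of [Balaban1987RG1] p. 256 ∕ p. 298 lives in a coupling-READING functional. [cite: Balaban1987RG1, §0 p.256 and §5 p.298] -/
theorem ne9_reFunctional (N : ℕ → ℕ) [∀ j, NeZero (N j)] (W : (j : ℕ) → TwoTorusStep 4 L (N j))
    (E : (j : ℕ) → TDom 4 (N j) → (W j).Φ → ℂ) (W' : Set (ℕ → ℝ)) (κ ω : ℝ) :
    NE9 (C := torusCarriers N W) (reFunctional N W E) W' κ (fun _ _ => 0) ∧ FadingMemory 0 ω (fun _ _ => 0) :=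
  ⟨ne9_zero_of_couplingBlind (reFunctional_couplingBlind N W E) W' κ, fadingMemory_zero ω⟩

/-! ## §3 The β-read-out at coupling-blind functionals forces constant β-functions -/

/-- If a coupling-blind functional REPRESENTS the β-functions on the boxes (the (D4) read-out binder `RepresentsA`,
[Balaban1987RG1] (1.20)–(1.22) p. 264: β_{j+1} is read off E^{(j+1)}(g_j, ·)), then every `β k` is CONSTANT on the box
`]0, γ]^{k+1}`. [cite: Balaban1987RG1, (1.20)-(1.22) p.264] -/
theorem representsA_const_of_couplingBlind {C : Carriers} {Bg : Type} {E : Functional C Bg}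
    (hE : ∀ g g' : ℕ → ℝ, E g = E g') {r : ReadOut C Bg} {γ : ℝ} {β : HBeta} (h : RepresentsA E r γ β)
    (k : ℕ) {v v' : Fin (k + 1) → ℝ} (hv : v ∈ Box γ k) (hv' : v' ∈ Box γ k) : β k v = β k v' := by
  rw [h k v hv, h k v' hv', hE]

/-- At the NE5 chain's read-outs: `RepresentsA (reFunctional N W E) rA γ β` forces `β k` constant on every box — the
datum's running β-functions cannot be represented there. [cite: Balaban1987RG1, (0.20) p.256 and (1.20)-(1.22) p.264] -/
theorem representsA_reFunctional_const (N : ℕ → ℕ) [∀ j, NeZero (N j)] (W : (j : ℕ) → TwoTorusStep 4 L (N j))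
    (E : (j : ℕ) → TDom 4 (N j) → (W j).Φ → ℂ) {rA : ReadOut (torusCarriers N W) (torusCarriers N W).BgA}
    {γ : ℝ} {β : HBeta} (h : RepresentsA (C := torusCarriers N W) (reFunctional N W E) rA γ β) (k : ℕ)
    {v v' : Fin (k + 1) → ℝ} (hv : v ∈ Box γ k) (hv' : v' ∈ Box γ k) : β k v = β k v' :=
  representsA_const_of_couplingBlind (fun _ _ => rfl) h k hv hv'

/-- Run B's family version: if `b ↦ reFunctional N W (E₁ b)` represents the β-functions one step later (`RepresentsB`),
then `β (k+1) w` depends on the unpaired first coupling `w 0` ALONE. [cite: Balaban1987RG1, (1.20)-(1.22) p.264] -/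
theorem representsB_reFunctional_head (N : ℕ → ℕ) [∀ j, NeZero (N j)] (W : (j : ℕ) → TwoTorusStep 4 L (N j))
    (E₁ : ℝ → (j : ℕ) → TDom 4 (N j) → (W j).Φ → ℂ) {rB : ReadOut (torusCarriers N W) (torusCarriers N W).BgB}
    {γ : ℝ} {β : HBeta} (h : RepresentsB (C := torusCarriers N W) (fun b => reFunctional N W (E₁ b)) rB γ β)
    (k : ℕ) {w w' : Fin (k + 2) → ℝ} (hw : w ∈ Box γ (k + 1)) (hw' : w' ∈ Box γ (k + 1)) (h0 : w 0 = w' 0) :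
    β (k + 1) w = β (k + 1) w' := by
  rw [h k w hw, h k w' hw', h0]
  rfl

/-! ## §4 The positive counterpart: the coupling-READING read-out on the same carriers -/

open Classical in
/-- **N18's K4 FAMILY SHAPE AT THE COUPLING-READING READ-OUT, FROM PER-COUPLING DATA.**  Carriers `torusCarriers N W`;
run A's functional `g ↦ reFunctional N W (E₀ g) g` and run B's family `b ↦ (g ↦ reFunctional N W (E₁ b g) g)` READ the
coupling sequence through coupling-indexed output families `E₀ g`, `E₁ b g` (so §2–§3 do not apply to them).  In-edges
as binders, uniformly on the window `W′`: (N10 ∕ NODE A) one-run envelopes per coupling sequence ([Balaban1988RG2Cluster]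
(2.41) per run); (rows NE2∕NE3) the primitive two-run rate `r_j ≤ C₂θ^j`; (NODE O) per member and coupling sequence, at the
window scales `θ^j < s₀∕C₂`, the two-run bound at pencil radius `s₀∕r_j`.  Conclusion: `∀ b ∈ ]0, γ], NE5 (g ↦ reFunctional
(E₀ g) g) (g ↦ reFunctional (E₁ b g) g) W′ κ′ θ (2AC₂∕s₀)` BY NAME — the companion's `ne5_family_of_primitive_rate` at each
`g ∈ W′` (T16 `ne5_of_torus_rates_all_scales` inside). [cite: Balaban1987RG1, (1.18) p.263; Balaban1988RG2Cluster, (2.41) p.21; King1986, Thm 3.4 (3.9) p.656, p.665] -/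
theorem ne5_family_couplingReading_of_primitive_rate (N : ℕ → ℕ) [∀ j, NeZero (N j)]
    (W : (j : ℕ) → TwoTorusStep 4 L (N j)) (γ : ℝ)
    (E₀ : (ℕ → ℝ) → (j : ℕ) → TDom 4 (N j) → (W j).Φ → ℂ)
    (E₁ : ℝ → (ℕ → ℝ) → (j : ℕ) → TDom 4 (N j) → (W j).Φ → ℂ)
    {A κ' θ C₂ s₀ : ℝ} {r : ℕ → ℝ} (hA : 0 ≤ A) (hθ : 0 < θ) (hC₂ : 0 < C₂) (hs₀ : 0 < s₀)
    (hr : ∀ j, 0 < r j) (hrate : ∀ j, r j ≤ C₂ * θ ^ j) (W' : Set (ℕ → ℝ))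
    (hA1 : ∀ g ∈ W', ∀ (j : ℕ) (X : TDom 4 (N j)) (φ : (W j).Φ), φ ∈ (W j).sp2 X →
      ‖E₀ g j X φ‖ ≤ A * Real.exp (-(κ' * (tsys 4 (N j)).dj X)))
    (hB1 : ∀ b : ℝ, 0 < b → b ≤ γ → ∀ g ∈ W', ∀ (j : ℕ) (X : TDom 4 (N j)) (φ : (W j).Φ), φ ∈ (W j).sp2 X →
      ‖E₁ b g j X φ‖ ≤ A * Real.exp (-(κ' * (tsys 4 (N j)).dj X)))
    (hE : ∀ b : ℝ, 0 < b → b ≤ γ → ∀ g ∈ W', ∀ (j : ℕ), θ ^ j < s₀ / C₂ → ∀ (X : TDom 4 (N j)) (φ : (W j).Φ),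
      φ ∈ (W j).sp2 X →
      ‖E₁ b g j X φ - E₀ g j X φ‖ ≤ 2 * (A * Real.exp (-(κ' * (tsys 4 (N j)).dj X))) / (s₀ / r j)) :
    ∀ b : ℝ, 0 < b → b ≤ γ →
      NE5 (C := torusCarriers N W) (fun g => reFunctional N W (E₀ g) g) (fun g => reFunctional N W (E₁ b g) g)
        W' κ' θ (2 * A * C₂ / s₀) := by
  intro b hb hbγ g hg U X
  have hs : 0 < s₀ / C₂ := div_pos hs₀ hC₂
  -- the rate is inherited: pencil radius `s₀∕r_j ≥ (s₀∕C₂)∕θ^j` at the window scales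
  have key : ∀ (j : ℕ), θ ^ j < s₀ / C₂ → ∀ (X : TDom 4 (N j)) (φ : (W j).Φ), φ ∈ (W j).sp2 X →
      ‖E₁ b g j X φ - E₀ g j X φ‖ ≤ 2 * (A * Real.exp (-(κ' * (tsys 4 (N j)).dj X))) / (s₀ / C₂ / θ ^ j) := by
    intro j hj X φ hφ
    have hθj : 0 < θ ^ j := pow_pos hθ j
    have hρ : s₀ / C₂ / θ ^ j ≤ s₀ / r j := by
      rw [div_div]
      exact div_le_div_of_nonneg_left hs₀.le (hr j) (hrate j)
    calc ‖E₁ b g j X φ - E₀ g j X φ‖ ≤ 2 * (A * Real.exp (-(κ' * (tsys 4 (N j)).dj X))) / (s₀ / r j) :=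
          hE b hb hbγ g hg j hj X φ hφ
      _ ≤ 2 * (A * Real.exp (-(κ' * (tsys 4 (N j)).dj X))) / (s₀ / C₂ / θ ^ j) :=
          div_le_div_of_nonneg_left (by positivity) (by positivity) hρ
  have h := ne5_of_torus_rates_all_scales N W (E₀ g) (E₁ b g) hA hθ hs (hA1 g hg) (hB1 b hb hbγ g hg) key W'
    g hg U X
  have hc : 2 * A / (s₀ / C₂) = 2 * A * C₂ / s₀ := by field_simp
  rw [hc] at h
  exact h

end Summit.QuantumFields.YangMills.BalabanUVNodes.N18Coherence

end
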